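import Literature.NumberTheory.EllipticCurves.HeathBrown1994.CongruentTwoSelmerMonskyFamilies
import Literature.NumberTheory.EllipticCurves.CongruentNumberMonskySelmerRankZero
import HarnessLib

/-!
# The classical non-congruent families: `#Sel⁽²⁾(E_n/ℚ) = 4`, rank `0` AND `Ш(E_n)[2^∞] = 0`, UNCONDITIONALLY and uniformly
# (`p₃`, `2p₅`, `p₃q₃`, `2p₅q₅`, `p₁q₃` / `2p₁q₅` / `p₅q₇` / `2p₃q₇` with symbol `−1`, `2p₃q₃`; `n = 1, 2`)

Topic `NumberTheory/EllipticCurves`; namespace `Literature.NumberTheory.EllipticCurves.CongruentNumberMonskySelmer`. A pure proof file.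

`HeathBrown1994/CongruentTwoSelmerMonskyFamilies.lean` PROVES `det M = 1` (Monsky's matrix, odd/even) UNIFORMLY on the eleven classical
congruence families of square-free `n` with at most two odd prime factors on which `s(n) = 0` (`p_i, q_i` primes `≡ i (mod 8)`): `1`, `2`,
`p₃`, `2p₅`, `p₃q₃`, `2p₅q₅`, `p₁q₃` with `(p/q) = −1`, `2p₁q₅` with `(p/q) = −1`, `p₅q₇` with `(p/q) = −1`, `2p₃q₃`, `2p₃q₇` with
`(p/q) = −1` — and derives `BSD(E_n, ℓ)` for them MODULO Monsky's theorem `hM` and the three journal facts. With the upper bound of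
Monsky's formula now a tree theorem (`CongruentNumber{Odd,Even}MonskySelmerBound.lean`) and `det M = 1 ⟹ #Sel₂ = 4` fact-free
(`CongruentNumberMonskySelmerRankZero.lean`), THIS FILE records, for every member of every family with a prime factor (`n = 1, 2` are the instances `card_selmerGroup_two_congruentNumberCurve_1/2` of `P2/CongruentNumberPairsAtTwoRankZero{Odd,Even}Descent.lean`), UNCONDITIONALLY:
`#Sel⁽²⁾(E_n/ℚ) = 4` (`card_selmerGroup_two_<family>`), hence **`rk E_n(ℚ) = 0` and `Ш(E_n/ℚ)[2^∞] = 0`** (`rank_zero_sha_two_<family>`) —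
the rank half is the classical non-congruence (Genocchi 1855, Lagrange 1974; Knapp Prop. 4.23 for `p₃`, already in the tree by
rational-point descent), the `Ш` half («the `2`-descent is sharp on these families: `Sel₂ = E[2]`») is new in the tree as an
unconditional statement. For the two one-prime families also `BSD(E_n, ℓ)` for every prime `ℓ` modulo the JOURNAL facts only
(`forall_bsdp_<family>_descent`). Nothing about any census class is booked here.

## References

* [HeathBrown1994SelmerCongruentII] D. R. Heath-Brown, Invent. Math. 118 (1994), §1 p. 6 L26–L28; Appendix (P. Monsky) pp. 38–42.
* [Feng1996NonCongruent] K. Feng, Acta Arith. 75 (1996) 71–83, §1 (the classical lists: Genocchi 1855, Bastien 1913, Lagrange 1974).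
* [Knapp1993] A. W. Knapp, *Elliptic Curves*, Prop. 4.23. [Monsky1990MockHeegner] Math. Z. 204 (1990), Thms. 5.13/5.14, Remark (2).
* [SilvermanAEC2009] Thm. X.4.2, Prop. X.1.4. [BurungaleTian2026] Thm. 1.1. [BurungaleFlach2024] Thm. 1.1, Cor. 2. [Miller2011LMS] Def. 1.1.
-/

noncomputable section

open scoped Classical

open WeierstrassCurve Literature.NumberTheory.EllipticCurves.HeathBrown1994
  Literature.NumberTheory.EllipticCurves.HeathBrown1994.Families

namespace Literature.NumberTheory.EllipticCurves

namespace CongruentNumberMonskySelmer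

/-! ## §1 The one- and two-prime families (`n = 1, 2`: see `P2/CongruentNumberPairsAtTwoRankZero{Odd,Even}Descent.lean`) -/

/-- **`#Sel⁽²⁾(E_n/ℚ) = 4` for every prime `p ≡ 3 (mod 8)` (`E_p`; Genocchi 1855 / Knapp Prop. 4.23 for the rank)**, unconditionally (`det M = 1` uniformly + the tree's `2`-descent bound + the descent count).
[cite: HeathBrown1994SelmerCongruentII, §1 typescript p. 6 L26–L28 (s(p) = 0 for p ≡ 3 (mod 8))] [cite: Knapp1993, Prop. 4.23] [cite: SilvermanAEC2009, Thm. X.4.2] -/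
theorem card_selmerGroup_two_prime_three_mod_eight {p : ℕ} (hp : p.Prime) (h8 : p % 8 = 3) :
    Nat.card ((congruentNumberCurve (p)).selmerGroup 2) = 4 :=
  card_selmerGroup_two_eq_four_of_det_odd' ![p] (by simp) (fun i => by fin_cases i; exact hp)
    (fun i => by fin_cases i; exact Nat.odd_iff.mpr (by simp; omega)) (Function.injective_of_subsingleton _) (det_monskyMatrixOdd_three_mod_eight h8)

/-- **rank `E_n(ℚ) = 0` AND `Ш(E_n/ℚ)[2^∞] = 0` for every prime `p ≡ 3 (mod 8)` (`E_p`; Genocchi 1855 / Knapp Prop. 4.23 for the rank)** — UNCONDITIONAL, uniformly in the primes.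
[cite: HeathBrown1994SelmerCongruentII, §1 typescript p. 6 L26–L28 (s(p) = 0 for p ≡ 3 (mod 8))] [cite: Knapp1993, Prop. 4.23] [cite: SilvermanAEC2009, Thm. X.4.2] -/
theorem rank_zero_sha_two_prime_three_mod_eight {p : ℕ} (hp : p.Prime) (h8 : p % 8 = 3) :
    (haveI := isElliptic_congruentNumberCurve (n := p) hp.ne_zero; (congruentNumberCurve (p)).mordellWeilRank = 0) ∧
    (haveI := isElliptic_congruentNumberCurve (n := p) hp.ne_zero;
      AddCommGroup.primaryComponent (congruentNumberCurve (p)).sha 2 = ⊥) :=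
  ⟨Smith2016.mordellWeilRank_eq_zero_of_card_selmerGroup_two hp.ne_zero (card_selmerGroup_two_prime_three_mod_eight hp h8),
    Smith2016.primaryComponent_sha_two_eq_bot_of_card_selmerGroup_two hp.ne_zero (card_selmerGroup_two_prime_three_mod_eight hp h8)⟩

/-- **`#Sel⁽²⁾(E_n/ℚ) = 4` for every `n = 2p`, `p ≡ 5 (mod 8)` prime (Genocchi / Bastien)**, unconditionally (`det M = 1` uniformly + the tree's `2`-descent bound + the descent count).
[cite: Monsky1990MockHeegner, Remark (2) p. 67 with Thms. 5.13/5.14 pp. 65–66] [cite: Feng1996NonCongruent, §1 p. 72 L1–L2] [cite: SilvermanAEC2009, Thm. X.4.2] -/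
theorem card_selmerGroup_two_two_mul_prime_five_mod_eight {p : ℕ} (hp : p.Prime) (h8 : p % 8 = 5) :
    Nat.card ((congruentNumberCurve (2 * p)).selmerGroup 2) = 4 :=
  card_selmerGroup_two_eq_four_of_det_even' ![p] (by simp) (fun i => by fin_cases i; exact hp)
    (fun i => by fin_cases i; exact Nat.odd_iff.mpr (by simp; omega)) (Function.injective_of_subsingleton _) (det_monskyMatrixEven_five_mod_eight h8)

/-- **rank `E_n(ℚ) = 0` AND `Ш(E_n/ℚ)[2^∞] = 0` for every `n = 2p`, `p ≡ 5 (mod 8)` prime (Genocchi / Bastien)** — UNCONDITIONAL, uniformly in the primes.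
[cite: Monsky1990MockHeegner, Remark (2) p. 67 with Thms. 5.13/5.14 pp. 65–66] [cite: Feng1996NonCongruent, §1 p. 72 L1–L2] [cite: SilvermanAEC2009, Thm. X.4.2] -/
theorem rank_zero_sha_two_two_mul_prime_five_mod_eight {p : ℕ} (hp : p.Prime) (h8 : p % 8 = 5) :
    (haveI := isElliptic_congruentNumberCurve (n := 2 * p) (by have := hp.pos; omega); (congruentNumberCurve (2 * p)).mordellWeilRank = 0) ∧
    (haveI := isElliptic_congruentNumberCurve (n := 2 * p) (by have := hp.pos; omega);
      AddCommGroup.primaryComponent (congruentNumberCurve (2 * p)).sha 2 = ⊥) :=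
  ⟨Smith2016.mordellWeilRank_eq_zero_of_card_selmerGroup_two (by have := hp.pos; omega) (card_selmerGroup_two_two_mul_prime_five_mod_eight hp h8),
    Smith2016.primaryComponent_sha_two_eq_bot_of_card_selmerGroup_two (by have := hp.pos; omega) (card_selmerGroup_two_two_mul_prime_five_mod_eight hp h8)⟩

/-- **`#Sel⁽²⁾(E_n/ℚ) = 4` for Genocchi's `n = pq`, `p ≡ q ≡ 3 (mod 8)`**, unconditionally (`det M = 1` uniformly + the tree's `2`-descent bound + the descent count).
[cite: Feng1996NonCongruent, §1 p. 72 L1–L2 (Genocchi 1855)] [cite: SilvermanAEC2009, Thm. X.4.2] -/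
theorem card_selmerGroup_two_three_three_mod_eight {p q : ℕ} (hp : p.Prime) (hq : q.Prime) (hne : p ≠ q) (hp8 : p % 8 = 3) (hq8 : q % 8 = 3) :
    Nat.card ((congruentNumberCurve (p * q)).selmerGroup 2) = 4 :=
  card_selmerGroup_two_eq_four_of_det_odd' ![p, q] prod_vecPair (fun i => by fin_cases i <;> assumption)
    (fun i => by fin_cases i <;> exact Nat.odd_iff.mpr (by simp; omega)) (injective_vecPair hne) (det_monskyMatrixOdd_three_three_mod_eight hp hq hne hp8 hq8)

/-- **rank `E_n(ℚ) = 0` AND `Ш(E_n/ℚ)[2^∞] = 0` for Genocchi's `n = pq`, `p ≡ q ≡ 3 (mod 8)`** — UNCONDITIONAL, uniformly in the primes.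
[cite: Feng1996NonCongruent, §1 p. 72 L1–L2 (Genocchi 1855)] [cite: SilvermanAEC2009, Thm. X.4.2] -/
theorem rank_zero_sha_two_three_three_mod_eight {p q : ℕ} (hp : p.Prime) (hq : q.Prime) (hne : p ≠ q) (hp8 : p % 8 = 3) (hq8 : q % 8 = 3) :
    (haveI := isElliptic_congruentNumberCurve (n := p * q) (Nat.mul_ne_zero hp.ne_zero hq.ne_zero); (congruentNumberCurve (p * q)).mordellWeilRank = 0) ∧
    (haveI := isElliptic_congruentNumberCurve (n := p * q) (Nat.mul_ne_zero hp.ne_zero hq.ne_zero);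
      AddCommGroup.primaryComponent (congruentNumberCurve (p * q)).sha 2 = ⊥) :=
  ⟨Smith2016.mordellWeilRank_eq_zero_of_card_selmerGroup_two (Nat.mul_ne_zero hp.ne_zero hq.ne_zero) (card_selmerGroup_two_three_three_mod_eight hp hq hne hp8 hq8),
    Smith2016.primaryComponent_sha_two_eq_bot_of_card_selmerGroup_two (Nat.mul_ne_zero hp.ne_zero hq.ne_zero) (card_selmerGroup_two_three_three_mod_eight hp hq hne hp8 hq8)⟩

/-- **`#Sel⁽²⁾(E_n/ℚ) = 4` for Genocchi's `n = 2pq`, `p ≡ q ≡ 5 (mod 8)`**, unconditionally (`det M = 1` uniformly + the tree's `2`-descent bound + the descent count).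
[cite: Feng1996NonCongruent, §1 p. 72 L1–L2 (Genocchi 1855)] [cite: SilvermanAEC2009, Thm. X.4.2] -/
theorem card_selmerGroup_two_two_mul_five_five_mod_eight {p q : ℕ} (hp : p.Prime) (hq : q.Prime) (hne : p ≠ q) (hp8 : p % 8 = 5) (hq8 : q % 8 = 5) :
    Nat.card ((congruentNumberCurve (2 * (p * q))).selmerGroup 2) = 4 :=
  card_selmerGroup_two_eq_four_of_det_even' ![p, q] (by rw [prod_vecPair]) (fun i => by fin_cases i <;> assumption)
    (fun i => by fin_cases i <;> exact Nat.odd_iff.mpr (by simp; omega)) (injective_vecPair hne) (det_monskyMatrixEven_five_five_mod_eight hp hq hne hp8 hq8)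

/-- **rank `E_n(ℚ) = 0` AND `Ш(E_n/ℚ)[2^∞] = 0` for Genocchi's `n = 2pq`, `p ≡ q ≡ 5 (mod 8)`** — UNCONDITIONAL, uniformly in the primes.
[cite: Feng1996NonCongruent, §1 p. 72 L1–L2 (Genocchi 1855)] [cite: SilvermanAEC2009, Thm. X.4.2] -/
theorem rank_zero_sha_two_two_mul_five_five_mod_eight {p q : ℕ} (hp : p.Prime) (hq : q.Prime) (hne : p ≠ q) (hp8 : p % 8 = 5) (hq8 : q % 8 = 5) :
    (haveI := isElliptic_congruentNumberCurve (n := 2 * (p * q)) (Nat.mul_ne_zero two_ne_zero (Nat.mul_ne_zero hp.ne_zero hq.ne_zero)); (congruentNumberCurve (2 * (p * q))).mordellWeilRank = 0) ∧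
    (haveI := isElliptic_congruentNumberCurve (n := 2 * (p * q)) (Nat.mul_ne_zero two_ne_zero (Nat.mul_ne_zero hp.ne_zero hq.ne_zero));
      AddCommGroup.primaryComponent (congruentNumberCurve (2 * (p * q))).sha 2 = ⊥) :=
  ⟨Smith2016.mordellWeilRank_eq_zero_of_card_selmerGroup_two (Nat.mul_ne_zero two_ne_zero (Nat.mul_ne_zero hp.ne_zero hq.ne_zero)) (card_selmerGroup_two_two_mul_five_five_mod_eight hp hq hne hp8 hq8),
    Smith2016.primaryComponent_sha_two_eq_bot_of_card_selmerGroup_two (Nat.mul_ne_zero two_ne_zero (Nat.mul_ne_zero hp.ne_zero hq.ne_zero)) (card_selmerGroup_two_two_mul_five_five_mod_eight hp hq hne hp8 hq8)⟩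

/-- **`#Sel⁽²⁾(E_n/ℚ) = 4` for Lagrange's `n = pq`, `p ≡ 1`, `q ≡ 3 (mod 8)`, `(p/q) = −1`**, unconditionally (`det M = 1` uniformly + the tree's `2`-descent bound + the descent count).
[cite: Feng1996NonCongruent, §1 p. 72 L7–L12 (Lagrange 1974)] [cite: SilvermanAEC2009, Thm. X.4.2] -/
theorem card_selmerGroup_two_one_three_mod_eight {p q : ℕ} (hp : p.Prime) (hq : q.Prime) (hp8 : p % 8 = 1) (hq8 : q % 8 = 3) (hpq : jacobiSym (p : ℤ) q = -1) :
    Nat.card ((congruentNumberCurve (p * q)).selmerGroup 2) = 4 :=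
  card_selmerGroup_two_eq_four_of_det_odd' ![p, q] prod_vecPair (fun i => by fin_cases i <;> assumption)
    (fun i => by fin_cases i <;> exact Nat.odd_iff.mpr (by simp; omega)) (injective_vecPair (by omega)) (det_monskyMatrixOdd_one_three_mod_eight hp hq hp8 hq8 hpq)

/-- **rank `E_n(ℚ) = 0` AND `Ш(E_n/ℚ)[2^∞] = 0` for Lagrange's `n = pq`, `p ≡ 1`, `q ≡ 3 (mod 8)`, `(p/q) = −1`** — UNCONDITIONAL, uniformly in the primes.
[cite: Feng1996NonCongruent, §1 p. 72 L7–L12 (Lagrange 1974)] [cite: SilvermanAEC2009, Thm. X.4.2] -/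
theorem rank_zero_sha_two_one_three_mod_eight {p q : ℕ} (hp : p.Prime) (hq : q.Prime) (hp8 : p % 8 = 1) (hq8 : q % 8 = 3) (hpq : jacobiSym (p : ℤ) q = -1) :
    (haveI := isElliptic_congruentNumberCurve (n := p * q) (Nat.mul_ne_zero hp.ne_zero hq.ne_zero); (congruentNumberCurve (p * q)).mordellWeilRank = 0) ∧
    (haveI := isElliptic_congruentNumberCurve (n := p * q) (Nat.mul_ne_zero hp.ne_zero hq.ne_zero);
      AddCommGroup.primaryComponent (congruentNumberCurve (p * q)).sha 2 = ⊥) :=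
  ⟨Smith2016.mordellWeilRank_eq_zero_of_card_selmerGroup_two (Nat.mul_ne_zero hp.ne_zero hq.ne_zero) (card_selmerGroup_two_one_three_mod_eight hp hq hp8 hq8 hpq),
    Smith2016.primaryComponent_sha_two_eq_bot_of_card_selmerGroup_two (Nat.mul_ne_zero hp.ne_zero hq.ne_zero) (card_selmerGroup_two_one_three_mod_eight hp hq hp8 hq8 hpq)⟩

/-- **`#Sel⁽²⁾(E_n/ℚ) = 4` for Lagrange's `n = 2pq`, `p ≡ 1`, `q ≡ 5 (mod 8)`, `(p/q) = −1`**, unconditionally (`det M = 1` uniformly + the tree's `2`-descent bound + the descent count).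
[cite: Feng1996NonCongruent, §1 p. 72 L7–L12 (Lagrange 1974)] [cite: SilvermanAEC2009, Thm. X.4.2] -/
theorem card_selmerGroup_two_two_mul_one_five_mod_eight {p q : ℕ} (hp : p.Prime) (hq : q.Prime) (hp8 : p % 8 = 1) (hq8 : q % 8 = 5) (hpq : jacobiSym (p : ℤ) q = -1) :
    Nat.card ((congruentNumberCurve (2 * (p * q))).selmerGroup 2) = 4 :=
  card_selmerGroup_two_eq_four_of_det_even' ![p, q] (by rw [prod_vecPair]) (fun i => by fin_cases i <;> assumption)
    (fun i => by fin_cases i <;> exact Nat.odd_iff.mpr (by simp; omega)) (injective_vecPair (by omega)) (det_monskyMatrixEven_one_five_mod_eight hp hq hp8 hq8 hpq)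

/-- **rank `E_n(ℚ) = 0` AND `Ш(E_n/ℚ)[2^∞] = 0` for Lagrange's `n = 2pq`, `p ≡ 1`, `q ≡ 5 (mod 8)`, `(p/q) = −1`** — UNCONDITIONAL, uniformly in the primes.
[cite: Feng1996NonCongruent, §1 p. 72 L7–L12 (Lagrange 1974)] [cite: SilvermanAEC2009, Thm. X.4.2] -/
theorem rank_zero_sha_two_two_mul_one_five_mod_eight {p q : ℕ} (hp : p.Prime) (hq : q.Prime) (hp8 : p % 8 = 1) (hq8 : q % 8 = 5) (hpq : jacobiSym (p : ℤ) q = -1) :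
    (haveI := isElliptic_congruentNumberCurve (n := 2 * (p * q)) (Nat.mul_ne_zero two_ne_zero (Nat.mul_ne_zero hp.ne_zero hq.ne_zero)); (congruentNumberCurve (2 * (p * q))).mordellWeilRank = 0) ∧
    (haveI := isElliptic_congruentNumberCurve (n := 2 * (p * q)) (Nat.mul_ne_zero two_ne_zero (Nat.mul_ne_zero hp.ne_zero hq.ne_zero));
      AddCommGroup.primaryComponent (congruentNumberCurve (2 * (p * q))).sha 2 = ⊥) :=
  ⟨Smith2016.mordellWeilRank_eq_zero_of_card_selmerGroup_two (Nat.mul_ne_zero two_ne_zero (Nat.mul_ne_zero hp.ne_zero hq.ne_zero)) (card_selmerGroup_two_two_mul_one_five_mod_eight hp hq hp8 hq8 hpq),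
    Smith2016.primaryComponent_sha_two_eq_bot_of_card_selmerGroup_two (Nat.mul_ne_zero two_ne_zero (Nat.mul_ne_zero hp.ne_zero hq.ne_zero)) (card_selmerGroup_two_two_mul_one_five_mod_eight hp hq hp8 hq8 hpq)⟩

/-- **`#Sel⁽²⁾(E_n/ℚ) = 4` for `n = pq`, `p ≡ 5`, `q ≡ 7 (mod 8)`, `(p/q) = −1`**, unconditionally (`det M = 1` uniformly + the tree's `2`-descent bound + the descent count).
[cite: HeathBrown1994SelmerCongruentII, Appendix (Monsky), typescript pp. 39–41 (evaluation of the matrix)] [cite: SilvermanAEC2009, Thm. X.4.2] -/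
theorem card_selmerGroup_two_five_seven_mod_eight {p q : ℕ} (hp : p.Prime) (hq : q.Prime) (hp8 : p % 8 = 5) (hq8 : q % 8 = 7) (hpq : jacobiSym (p : ℤ) q = -1) :
    Nat.card ((congruentNumberCurve (p * q)).selmerGroup 2) = 4 :=
  card_selmerGroup_two_eq_four_of_det_odd' ![p, q] prod_vecPair (fun i => by fin_cases i <;> assumption)
    (fun i => by fin_cases i <;> exact Nat.odd_iff.mpr (by simp; omega)) (injective_vecPair (by omega)) (det_monskyMatrixOdd_five_seven_mod_eight hp hq hp8 hq8 hpq)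

/-- **rank `E_n(ℚ) = 0` AND `Ш(E_n/ℚ)[2^∞] = 0` for `n = pq`, `p ≡ 5`, `q ≡ 7 (mod 8)`, `(p/q) = −1`** — UNCONDITIONAL, uniformly in the primes.
[cite: HeathBrown1994SelmerCongruentII, Appendix (Monsky), typescript pp. 39–41 (evaluation of the matrix)] [cite: SilvermanAEC2009, Thm. X.4.2] -/
theorem rank_zero_sha_two_five_seven_mod_eight {p q : ℕ} (hp : p.Prime) (hq : q.Prime) (hp8 : p % 8 = 5) (hq8 : q % 8 = 7) (hpq : jacobiSym (p : ℤ) q = -1) :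
    (haveI := isElliptic_congruentNumberCurve (n := p * q) (Nat.mul_ne_zero hp.ne_zero hq.ne_zero); (congruentNumberCurve (p * q)).mordellWeilRank = 0) ∧
    (haveI := isElliptic_congruentNumberCurve (n := p * q) (Nat.mul_ne_zero hp.ne_zero hq.ne_zero);
      AddCommGroup.primaryComponent (congruentNumberCurve (p * q)).sha 2 = ⊥) :=
  ⟨Smith2016.mordellWeilRank_eq_zero_of_card_selmerGroup_two (Nat.mul_ne_zero hp.ne_zero hq.ne_zero) (card_selmerGroup_two_five_seven_mod_eight hp hq hp8 hq8 hpq),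
    Smith2016.primaryComponent_sha_two_eq_bot_of_card_selmerGroup_two (Nat.mul_ne_zero hp.ne_zero hq.ne_zero) (card_selmerGroup_two_five_seven_mod_eight hp hq hp8 hq8 hpq)⟩

/-- **`#Sel⁽²⁾(E_n/ℚ) = 4` for `n = 2pq`, `p ≡ q ≡ 3 (mod 8)`**, unconditionally (`det M = 1` uniformly + the tree's `2`-descent bound + the descent count).
[cite: HeathBrown1994SelmerCongruentII, Appendix (Monsky), typescript pp. 39–41 (evaluation of the matrix)] [cite: SilvermanAEC2009, Thm. X.4.2] -/
theorem card_selmerGroup_two_two_mul_three_three_mod_eight {p q : ℕ} (hp : p.Prime) (hq : q.Prime) (hne : p ≠ q) (hp8 : p % 8 = 3) (hq8 : q % 8 = 3) :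
    Nat.card ((congruentNumberCurve (2 * (p * q))).selmerGroup 2) = 4 :=
  card_selmerGroup_two_eq_four_of_det_even' ![p, q] (by rw [prod_vecPair]) (fun i => by fin_cases i <;> assumption)
    (fun i => by fin_cases i <;> exact Nat.odd_iff.mpr (by simp; omega)) (injective_vecPair hne) (det_monskyMatrixEven_three_three_mod_eight hp hq hne hp8 hq8)

/-- **rank `E_n(ℚ) = 0` AND `Ш(E_n/ℚ)[2^∞] = 0` for `n = 2pq`, `p ≡ q ≡ 3 (mod 8)`** — UNCONDITIONAL, uniformly in the primes.
[cite: HeathBrown1994SelmerCongruentII, Appendix (Monsky), typescript pp. 39–41 (evaluation of the matrix)] [cite: SilvermanAEC2009, Thm. X.4.2] -/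
theorem rank_zero_sha_two_two_mul_three_three_mod_eight {p q : ℕ} (hp : p.Prime) (hq : q.Prime) (hne : p ≠ q) (hp8 : p % 8 = 3) (hq8 : q % 8 = 3) :
    (haveI := isElliptic_congruentNumberCurve (n := 2 * (p * q)) (Nat.mul_ne_zero two_ne_zero (Nat.mul_ne_zero hp.ne_zero hq.ne_zero)); (congruentNumberCurve (2 * (p * q))).mordellWeilRank = 0) ∧
    (haveI := isElliptic_congruentNumberCurve (n := 2 * (p * q)) (Nat.mul_ne_zero two_ne_zero (Nat.mul_ne_zero hp.ne_zero hq.ne_zero));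
      AddCommGroup.primaryComponent (congruentNumberCurve (2 * (p * q))).sha 2 = ⊥) :=
  ⟨Smith2016.mordellWeilRank_eq_zero_of_card_selmerGroup_two (Nat.mul_ne_zero two_ne_zero (Nat.mul_ne_zero hp.ne_zero hq.ne_zero)) (card_selmerGroup_two_two_mul_three_three_mod_eight hp hq hne hp8 hq8),
    Smith2016.primaryComponent_sha_two_eq_bot_of_card_selmerGroup_two (Nat.mul_ne_zero two_ne_zero (Nat.mul_ne_zero hp.ne_zero hq.ne_zero)) (card_selmerGroup_two_two_mul_three_three_mod_eight hp hq hne hp8 hq8)⟩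

/-- **`#Sel⁽²⁾(E_n/ℚ) = 4` for `n = 2pq`, `p ≡ 3`, `q ≡ 7 (mod 8)`, `(p/q) = −1`**, unconditionally (`det M = 1` uniformly + the tree's `2`-descent bound + the descent count).
[cite: HeathBrown1994SelmerCongruentII, Appendix (Monsky), typescript pp. 39–41 (evaluation of the matrix)] [cite: SilvermanAEC2009, Thm. X.4.2] -/
theorem card_selmerGroup_two_two_mul_three_seven_mod_eight {p q : ℕ} (hp : p.Prime) (hq : q.Prime) (hp8 : p % 8 = 3) (hq8 : q % 8 = 7) (hpq : jacobiSym (p : ℤ) q = -1) :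
    Nat.card ((congruentNumberCurve (2 * (p * q))).selmerGroup 2) = 4 :=
  card_selmerGroup_two_eq_four_of_det_even' ![p, q] (by rw [prod_vecPair]) (fun i => by fin_cases i <;> assumption)
    (fun i => by fin_cases i <;> exact Nat.odd_iff.mpr (by simp; omega)) (injective_vecPair (by omega)) (det_monskyMatrixEven_three_seven_mod_eight hp hq hp8 hq8 hpq)

/-- **rank `E_n(ℚ) = 0` AND `Ш(E_n/ℚ)[2^∞] = 0` for `n = 2pq`, `p ≡ 3`, `q ≡ 7 (mod 8)`, `(p/q) = −1`** — UNCONDITIONAL, uniformly in the primes.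
[cite: HeathBrown1994SelmerCongruentII, Appendix (Monsky), typescript pp. 39–41 (evaluation of the matrix)] [cite: SilvermanAEC2009, Thm. X.4.2] -/
theorem rank_zero_sha_two_two_mul_three_seven_mod_eight {p q : ℕ} (hp : p.Prime) (hq : q.Prime) (hp8 : p % 8 = 3) (hq8 : q % 8 = 7) (hpq : jacobiSym (p : ℤ) q = -1) :
    (haveI := isElliptic_congruentNumberCurve (n := 2 * (p * q)) (Nat.mul_ne_zero two_ne_zero (Nat.mul_ne_zero hp.ne_zero hq.ne_zero)); (congruentNumberCurve (2 * (p * q))).mordellWeilRank = 0) ∧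
    (haveI := isElliptic_congruentNumberCurve (n := 2 * (p * q)) (Nat.mul_ne_zero two_ne_zero (Nat.mul_ne_zero hp.ne_zero hq.ne_zero));
      AddCommGroup.primaryComponent (congruentNumberCurve (2 * (p * q))).sha 2 = ⊥) :=
  ⟨Smith2016.mordellWeilRank_eq_zero_of_card_selmerGroup_two (Nat.mul_ne_zero two_ne_zero (Nat.mul_ne_zero hp.ne_zero hq.ne_zero)) (card_selmerGroup_two_two_mul_three_seven_mod_eight hp hq hp8 hq8 hpq),
    Smith2016.primaryComponent_sha_two_eq_bot_of_card_selmerGroup_two (Nat.mul_ne_zero two_ne_zero (Nat.mul_ne_zero hp.ne_zero hq.ne_zero)) (card_selmerGroup_two_two_mul_three_seven_mod_eight hp hq hp8 hq8 hpq)⟩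

/-! ## §2 `BSD(E_n, ℓ)` for every prime `ℓ` on the one-prime families, modulo the JOURNAL facts only (Monsky's fact struck) -/

/-- **Every prime `p ≡ 3 (mod 8)`**: `BSD(E_p, ℓ)` for every prime `ℓ` from `det M = 1` (uniform) and the journal facts BT26 + Deuring–Hecke + BF24
ONLY — Monsky's theorem is no longer a binder. [cite: HeathBrown1994SelmerCongruentII, §1 typescript p. 6 L26–L28] [cite: BurungaleTian2026, Thm. 1.1 with Cor. 1.4]
[cite: BurungaleFlach2024, Cor. 2] [cite: Miller2011LMS, Def. 1.1] -/
theorem forall_bsdp_prime_three_mod_eight_descent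
    (hBT : burungaleTian_analyticRank_eq_zero_of_selmerCorank_eq_zero_of_hasCM)
    (hH : hasEntireLFunction_of_j_mem_maximalCMJInvariants)
    (hBF : bsdTriple_of_hasCM_of_L_one_ne_zero) {p : ℕ} (hp : p.Prime) (h8 : p % 8 = 3)
    (ℓ : ℕ) (hℓ : ℓ.Prime) :
    haveI := isElliptic_congruentNumberCurve (n := p) hp.ne_zero
    haveI := isGloballyMinimal_congruentNumberCurve (n := p) hp.squarefree
    BSDp (congruentNumberCurve p) ℓ := by
  have hprod : (∏ i, (![p] : Fin 1 → ℕ) i) = p := by simp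
  have h := forall_bsdp_of_BT_BF_odd_descent ![p] hBT hH hBF (fun i => by fin_cases i; exact hp)
    (fun i => by fin_cases i; exact Nat.odd_iff.mpr (by simp; omega)) (Function.injective_of_subsingleton _)
    (det_monskyMatrixOdd_three_mod_eight h8) ℓ hℓ
  simp only [hprod] at h
  convert h using 2

/-- **Every `n = 2p`, `p ≡ 5 (mod 8)` prime**: `BSD(E_{2p}, ℓ)` for every prime `ℓ`, modulo the journal facts ONLY.
[cite: Monsky1990MockHeegner, Remark (2) p. 67 with Thms. 5.13/5.14 pp. 65–66] [cite: BurungaleTian2026, Thm. 1.1 with Cor. 1.4] [cite: BurungaleFlach2024, Cor. 2]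
[cite: Miller2011LMS, Def. 1.1] -/
theorem forall_bsdp_two_mul_prime_five_mod_eight_descent
    (hBT : burungaleTian_analyticRank_eq_zero_of_selmerCorank_eq_zero_of_hasCM)
    (hH : hasEntireLFunction_of_j_mem_maximalCMJInvariants)
    (hBF : bsdTriple_of_hasCM_of_L_one_ne_zero) {p : ℕ} (hp : p.Prime) (h8 : p % 8 = 5)
    (ℓ : ℕ) (hℓ : ℓ.Prime) :
    haveI := isElliptic_congruentNumberCurve (n := 2 * p) (by have := hp.pos; omega)
    haveI := isGloballyMinimal_congruentNumberCurve (n := 2 * p) (squarefree_two_mul_of_prime hp (by omega))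
    BSDp (congruentNumberCurve (2 * p)) ℓ := by
  have hprod : (∏ i, (![p] : Fin 1 → ℕ) i) = p := by simp
  have h := forall_bsdp_of_BT_BF_even_descent ![p] hBT hH hBF (fun i => by fin_cases i; exact hp)
    (fun i => by fin_cases i; exact Nat.odd_iff.mpr (by simp; omega)) (Function.injective_of_subsingleton _)
    (det_monskyMatrixEven_five_mod_eight h8) ℓ hℓ
  simp only [hprod] at h
  convert h using 2

end CongruentNumberMonskySelmer

end Literature.NumberTheory.EllipticCurves

end
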